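import Summits.AtomisticToContinuum.Crystallization.Theorems.ChartedPlanarOrderPairModulus

-- PART B (lines 336–622 of lens-3 g24 `ChartedPlanarOrderPairModulus.lean`, sha256 54d68d2ec608f35d…): §3 Gram positivity / site floors /
-- summability, §4 uniform Lipschitz bound of the layer force, §5 span moduli and the pair modulus from a height floor; imports PART A.
-- Split for the 400-line rule by prover hand 1, gen 11 (--supports stmt-AtomisticToContinuum-26636); declarations byte-identical (gate-forced delta: docstrings added on the undocumented small lemmas).

/-!
# 7c′ᴾ — span moduli of the layer-pair force from a HEIGHT FLOOR (decomp-a2c lens-3 g24, task (v))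

The remaining ANALYTIC content of slot 7c′ (`…TubeConvex`/`…TubeConvexSplit`/`…StraddleLipschitz`): the layer-pair force
`v ↦ layerForce a b (−v)` (LJ 6–12, `…ProfileSlavingLJ`) is Lipschitz in the offset `v` of a layer pair of SPAN `s`, uniformly
along all `ρ`-tube profiles, with constant `τ s = K · s⁻⁶`, hence `Σ s³ τ s < ∞` — i.e. `…TubeMonotoneSplit.IsPairModulus a b w ρ τ`
with a summable third moment.  Everything is assembled from LANDED bricks:

* (o) `…PairForceLipschitz.pairForce_sub_le` — the per-site modulus `Φ(t) = 15 t⁻¹⁴ + 9 t⁻⁸` above the floor `t`;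
* (p) `…LayerForceLipschitz.norm_layerForce_sub_le_of_floor`, `le_inner_offsetOf` — summing per-site moduli over site floors, and
  the height of a span-`s` offset along a tube profile: `⟪ν, offsetOf h k l⟫ ≥ s (h₀ − ρ)`;
* (q) `…PlanarLatticeSums.norm_sq_site_ge`, `summable_inv_quad_sq`, `inv_pow_four_le_prod`, `inv_pow_seven_le`, `inv_sqrt_pow_two_mul`
  — the planar site floor `‖v + i a + j b‖² ≥ S := t² + q₁ (i + c₁)² + q₂ (j + c₂)²` (`q₁ = G/2‖b‖²`, `q₂ = G/2‖a‖²`, `G` the Gram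
  determinant) and `c`-wise summability.

NEW here (the «lattice sum ∼ t⁻⁶ per unit coarea» estimate promised in (p)'s docstring):
* §1 ★ `tsum_int_quadsq_le` — decay of the one-dimensional sum UNIFORM IN THE OFFSET: `Σ_{i∈ℤ} ((p + q(i+c)²)²)⁻¹ ≤ (2N+3) p⁻² + 2 q⁻² N⁻³`
  for every `N ≥ 1` (head of `2N+3` terms, tail by the telescoping `Σ_{n>N} n⁻⁴ ≤ N⁻³`);
* §2 ★ `tsum_sites_four_le`, `tsum_sites_seven_le`, `tsum_modulus_le` — uniform planar decay (product trick) and the modulus sum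
  `Σ_{(i,j)} Φ(√S) ≤ (15 t⁻⁶ + 9) · lineBound² `;
* §3 `gram_pos`, `sqrt_siteSq_le_norm`, `summable_layer` — Gram positivity of independent periods, the site floors, summability of a layer
  family at height `≥ t > 0`;
* §4 ★ `norm_layerForce_sub_le_of_height` — the UNIFORM Lipschitz bound of `layerForce a b` between two offsets of height `≥ t`;
* §5 ★★ `isPairModulus_of_heightFloor` / `pairModulus_of_heightFloor` (config level, explicit normal `ν` and floor `h₀ > ρ`; choosing
  `N = s`, `t = s(h₀ − ρ)` gives `τ s = spanConst · s⁻⁶`) and ★★ `pairModulus_of_cleanP_stacked` — for every `δ`-separated `IsCleanP aHi`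
  (`aHi ≤ 8/7`, so lens-4's `IsCleanW` at `103/100`) stacked layered configuration with `‖a‖, ‖b‖ ≤ 17/16` and every tube radius `ρ < 19/50`,
  via the uniform layer windows of (n) `…StackedUniform.stackedUniform` (floor `min(192/425, 8/17)·27/32 ≥ 19/50`).  This is the
  `∃ τ`-package consumed by `…StraddleLipschitz.tubeLipschitzData_of_pairModulus`; in particular it yields `PairModulusW' (17/16) ρ` and
  `PairModulusW (17/16) ρ` for all `ρ < 19/50` (so slot 7c′ at `ρ₀ = 1/40` reduces to its convexity half 7c′ᶜ alone) — that two-line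
  corollary is left to the file importing both.

Design-neutral (no W′/W statement is imported); six real-valued `def`s (`lineBound`, `siteSq`, `modulus`, `qA`, `qB`, `spanConst`), no Props;
no instances, no notation; sorry-free.
-/

open Finset Metric
open scoped RealInnerProductSpace
open Summit.AtomisticToContinuum.Crystallization.Theorems.ChartedPlanarOrderRigidityDoor (E3)
open Summit.AtomisticToContinuum.Crystallization.Theorems.ChartedPlanarOrderDensityDichotomy (IsSep μS)
open Summit.AtomisticToContinuum.Crystallization.Theorems.ChartedPlanarOrderDoorLayered (Layered)
open Summit.AtomisticToContinuum.Crystallization.Theorems.ChartedPlanarOrderCleanScaleP (IsCleanP linearIndependent_of_cleanP_stacked)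
open Summit.AtomisticToContinuum.Crystallization.Theorems.ChartedPlanarOrderProfileSlavingLJ (pairForce layerForce incr offsetOf tube
  IsStacked)
open Summit.AtomisticToContinuum.Crystallization.Theorems.ChartedPlanarOrderPairForceLipschitz (pairForce_sub_le norm_pairForce_le_of_le)
open Summit.AtomisticToContinuum.Crystallization.Theorems.ChartedPlanarOrderLayerForceLipschitz (le_inner_offsetOf
  norm_layerForce_sub_le_of_floor)
open Summit.AtomisticToContinuum.Crystallization.Theorems.ChartedPlanarOrderStraddleSummable (exists_coeffs_of_inner_eq_zero)
open Summit.AtomisticToContinuum.Crystallization.Theorems.ChartedPlanarOrderTubeMonotoneSplit (IsPairModulus)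
open Summit.AtomisticToContinuum.Crystallization.Theorems.ChartedPlanarOrderStackedUniform (stackedUniform)
open Summit.AtomisticToContinuum.Crystallization.Theorems.ChartedPlanarOrderPlanarLatticeSums (summable_inv_quad_sq
  summable_inv_one_add_sq_sq inv_pow_four_le_prod inv_pow_seven_le inv_sqrt_pow_two_mul summable_sites_four summable_sites_seven
  summable_modulus_sites norm_sq_site_ge)

noncomputable section

namespace Summit.AtomisticToContinuum.Crystallization.Theorems.ChartedPlanarOrderPairModulus

/-! ## §3 Gram positivity, site floors and summability of a layer family -/

/-- the Gram determinant of two independent vectors is positive. -/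
theorem gram_pos {a b : E3} (hab : LinearIndependent ℝ ![a, b]) : 0 < ‖a‖ ^ 2 * ‖b‖ ^ 2 - ⟪a, b⟫ ^ 2 := by
  have hb : b ≠ 0 := by simpa using hab.ne_zero 1
  have hcs : ⟪a, b⟫ ^ 2 ≤ (‖a‖ * ‖b‖) ^ 2 := by
    rw [← sq_abs]; exact pow_le_pow_left₀ (abs_nonneg _) (abs_real_inner_le_norm a b) 2
  have hG0 : 0 ≤ ‖a‖ ^ 2 * ‖b‖ ^ 2 - ⟪a, b⟫ ^ 2 := by rw [mul_pow] at hcs; linarith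
  rcases hG0.lt_or_eq with h | h
  · exact h
  exfalso
  have e1 : ‖(‖b‖ ^ 2) • a‖ = ‖b‖ ^ 2 * ‖a‖ := by rw [norm_smul, Real.norm_eq_abs, abs_of_nonneg (by positivity)]
  have e2 : ‖⟪a, b⟫ • b‖ = |⟪a, b⟫| * ‖b‖ := by rw [norm_smul, Real.norm_eq_abs]
  have e3 : ⟪(‖b‖ ^ 2) • a, ⟪a, b⟫ • b⟫ = ‖b‖ ^ 2 * (⟪a, b⟫ * ⟪a, b⟫) := by
    rw [real_inner_smul_left, real_inner_smul_right]
  have key : ‖(‖b‖ ^ 2) • a - ⟪a, b⟫ • b‖ ^ 2 = ‖b‖ ^ 2 * (‖a‖ ^ 2 * ‖b‖ ^ 2 - ⟪a, b⟫ ^ 2) := by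
    rw [norm_sub_sq_real, e3, e2, e1, mul_pow, mul_pow, sq_abs]; ring
  rw [← h, mul_zero, pow_eq_zero_iff two_ne_zero, norm_eq_zero, sub_eq_zero] at key
  have h2 := (LinearIndependent.pair_iff.1 hab) (‖b‖ ^ 2) (-⟪a, b⟫)
    (by rw [neg_smul, ← sub_eq_add_neg]; exact sub_eq_zero.2 key)
  exact hb (norm_eq_zero.1 ((pow_eq_zero_iff two_ne_zero).1 h2.1))

/-- the planar part of any vector is a combination of the periods. -/
theorem exists_planar {ν a b : E3} (hab : LinearIndependent ℝ ![a, b]) (hν : ‖ν‖ = 1) (hνa : ⟪ν, a⟫ = 0) (hνb : ⟪ν, b⟫ = 0)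
    (v : E3) : ∃ c₁ c₂ : ℝ, v - ⟪ν, v⟫ • ν = c₁ • a + c₂ • b :=
  exists_coeffs_of_inner_eq_zero hab hν hνa hνb (v := v - ⟪ν, v⟫ • ν)
    (by rw [inner_sub_right, real_inner_smul_right, real_inner_self_eq_norm_sq, hν]; ring)

/-- the planar coefficients `q₁ = G / 2‖b‖²`, `q₂ = G / 2‖a‖²` of the site floor (`G` the Gram determinant). -/
def qA (a b : E3) : ℝ := (‖a‖ ^ 2 * ‖b‖ ^ 2 - ⟪a, b⟫ ^ 2) / ‖b‖ ^ 2 / 2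

/-- see `qA`. -/
def qB (a b : E3) : ℝ := (‖a‖ ^ 2 * ‖b‖ ^ 2 - ⟪a, b⟫ ^ 2) / ‖a‖ ^ 2 / 2

/-- `0 < qA a b` for linearly independent `a, b`. [folklore] -/
theorem qA_pos {a b : E3} (hab : LinearIndependent ℝ ![a, b]) : 0 < qA a b := by
  have hb : b ≠ 0 := by simpa using hab.ne_zero 1
  unfold qA; exact div_pos (div_pos (gram_pos hab) (pow_pos (norm_pos_iff.2 hb) 2)) two_pos

/-- `0 < qB a b` for linearly independent `a, b`. [folklore] -/
theorem qB_pos {a b : E3} (hab : LinearIndependent ℝ ![a, b]) : 0 < qB a b := by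
  have ha : a ≠ 0 := by simpa using hab.ne_zero 0
  unfold qB; exact div_pos (div_pos (gram_pos hab) (pow_pos (norm_pos_iff.2 ha) 2)) two_pos

/-- ★ SITE FLOOR: `√S ≤ ‖v + (i a + j b)‖`, `S = siteSq t (qA a b) (qB a b) c₁ c₂ (i, j)`, whenever `t² ≤ ⟪ν, v⟫²` and the planar
part of `v` is `c₁ a + c₂ b` (from `…PlanarLatticeSums.norm_sq_site_ge`). -/
theorem sqrt_siteSq_le_norm {ν a b v : E3} {c₁ c₂ t : ℝ} (hν : ‖ν‖ = 1) (hνa : ⟪ν, a⟫ = 0) (hνb : ⟪ν, b⟫ = 0)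
    (ha0 : a ≠ 0) (hb0 : b ≠ 0) (hv : v - ⟪ν, v⟫ • ν = c₁ • a + c₂ • b) (htv : t ^ 2 ≤ ⟪ν, v⟫ ^ 2) (ij : ℤ × ℤ) :
    Real.sqrt (siteSq t (qA a b) (qB a b) c₁ c₂ ij) ≤ ‖v + ((ij.1 : ℝ) • a + (ij.2 : ℝ) • b)‖ := by
  have h := norm_sq_site_ge hν hνa hνb ha0 hb0 hv ij.1 ij.2
  have hle : siteSq t (qA a b) (qB a b) c₁ c₂ ij ≤ ‖v + ((ij.1 : ℝ) • a + (ij.2 : ℝ) • b)‖ ^ 2 := by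
    have e : siteSq t (qA a b) (qB a b) c₁ c₂ ij = t ^ 2 +
        ((‖a‖ ^ 2 * ‖b‖ ^ 2 - ⟪a, b⟫ ^ 2) / ‖b‖ ^ 2 * ((ij.1 : ℝ) + c₁) ^ 2 +
          (‖a‖ ^ 2 * ‖b‖ ^ 2 - ⟪a, b⟫ ^ 2) / ‖a‖ ^ 2 * ((ij.2 : ℝ) + c₂) ^ 2) / 2 := by
      unfold siteSq qA qB; ring
    rw [e]; linarith
  calc Real.sqrt (siteSq t (qA a b) (qB a b) c₁ c₂ ij) ≤ Real.sqrt (‖v + ((ij.1 : ℝ) • a + (ij.2 : ℝ) • b)‖ ^ 2) :=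
        Real.sqrt_le_sqrt hle
    _ = ‖v + ((ij.1 : ℝ) • a + (ij.2 : ℝ) • b)‖ := Real.sqrt_sq (norm_nonneg _)

/-- `t ≤ √S`. -/
theorem le_sqrt_siteSq {t q₁ q₂ : ℝ} (ht : 0 ≤ t) (hq₁ : 0 ≤ q₁) (hq₂ : 0 ≤ q₂) (c₁ c₂ : ℝ) (ij : ℤ × ℤ) :
    t ≤ Real.sqrt (siteSq t q₁ q₂ c₁ c₂ ij) := by
  rw [← Real.sqrt_sq ht]; exact Real.sqrt_le_sqrt (by rw [Real.sqrt_sq ht]; exact sq_le_siteSq hq₁ hq₂ c₁ c₂ ij)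

/-- summability of a layer family `(i, j) ↦ pairForce (v + i a + j b)` at height `|⟪ν, v⟫| ≥ t > 0`
(`‖pairForce x‖ ≤ r⁻¹³ + r⁻⁷ ≤ (t⁻⁹ + t⁻³) r⁻⁴` at `r = √S`, and `Σ (S²)⁻¹ < ∞`). -/
theorem summable_layer {ν a b v : E3} {t : ℝ} (hν : ‖ν‖ = 1) (hνa : ⟪ν, a⟫ = 0) (hνb : ⟪ν, b⟫ = 0)
    (hab : LinearIndependent ℝ ![a, b]) (ht : 0 < t) (htv : t ^ 2 ≤ ⟪ν, v⟫ ^ 2) :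
    Summable fun ij : ℤ × ℤ => pairForce (v + ((ij.1 : ℝ) • a + (ij.2 : ℝ) • b)) := by
  have ha0 : a ≠ 0 := by simpa using hab.ne_zero 0
  have hb0 : b ≠ 0 := by simpa using hab.ne_zero 1
  obtain ⟨c₁, c₂, hv⟩ := exists_planar hab hν hνa hνb v
  have hq₁ := qA_pos hab
  have hq₂ := qB_pos hab
  refine Summable.of_norm_bounded ((summable_siteSq_two ht hq₁ hq₂ c₁ c₂).mul_left (t⁻¹ ^ 9 + t⁻¹ ^ 3)) fun ij => ?_
  have hS := siteSq_pos ht hq₁.le hq₂.le c₁ c₂ ij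
  have hr0 : 0 < Real.sqrt (siteSq t (qA a b) (qB a b) c₁ c₂ ij) := Real.sqrt_pos.2 hS
  have hr := sqrt_siteSq_le_norm hν hνa hνb ha0 hb0 hv htv ij
  have h1 := norm_pairForce_le_of_le hr0 hr
  have htr : t ≤ Real.sqrt (siteSq t (qA a b) (qB a b) c₁ c₂ ij) := le_sqrt_siteSq ht.le hq₁.le hq₂.le c₁ c₂ ij
  have hinv : (Real.sqrt (siteSq t (qA a b) (qB a b) c₁ c₂ ij))⁻¹ ≤ t⁻¹ := inv_anti₀ ht htr
  have hi0 : 0 ≤ (Real.sqrt (siteSq t (qA a b) (qB a b) c₁ c₂ ij))⁻¹ := inv_nonneg.2 hr0.le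
  have hS4 : (Real.sqrt (siteSq t (qA a b) (qB a b) c₁ c₂ ij))⁻¹ ^ 4 = ((siteSq t (qA a b) (qB a b) c₁ c₂ ij) ^ 2)⁻¹ :=
    inv_sqrt_pow_two_mul hS.le 2
  have h9 := pow_le_pow_left₀ hi0 hinv 9
  have h3 := pow_le_pow_left₀ hi0 hinv 3
  have h4 : 0 ≤ (Real.sqrt (siteSq t (qA a b) (qB a b) c₁ c₂ ij))⁻¹ ^ 4 := pow_nonneg hi0 4
  calc ‖pairForce (v + ((ij.1 : ℝ) • a + (ij.2 : ℝ) • b))‖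
      ≤ (Real.sqrt (siteSq t (qA a b) (qB a b) c₁ c₂ ij))⁻¹ ^ 13 + (Real.sqrt (siteSq t (qA a b) (qB a b) c₁ c₂ ij))⁻¹ ^ 7 := h1
    _ = ((Real.sqrt (siteSq t (qA a b) (qB a b) c₁ c₂ ij))⁻¹ ^ 9 + (Real.sqrt (siteSq t (qA a b) (qB a b) c₁ c₂ ij))⁻¹ ^ 3) *
          (Real.sqrt (siteSq t (qA a b) (qB a b) c₁ c₂ ij))⁻¹ ^ 4 := by ring
    _ ≤ (t⁻¹ ^ 9 + t⁻¹ ^ 3) * (Real.sqrt (siteSq t (qA a b) (qB a b) c₁ c₂ ij))⁻¹ ^ 4 :=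
        mul_le_mul_of_nonneg_right (add_le_add h9 h3) h4
    _ = (t⁻¹ ^ 9 + t⁻¹ ^ 3) * ((siteSq t (qA a b) (qB a b) c₁ c₂ ij) ^ 2)⁻¹ := by rw [hS4]

/-! ## §4 The uniform Lipschitz bound of the layer force at height `≥ t` -/

/-- ★ UNIFORM LAYER-FORCE LIPSCHITZ BOUND: for independent planar periods `a, b` (unit normal `ν`) and two offsets `v, v'` of height
`|⟪ν, ·⟫| ≥ t > 0`, `‖layerForce a b v − layerForce a b v'‖ ≤ 2 (15 t⁻⁶ + 9) · lineBound(t²/2, q₁, N) · lineBound(t²/2, q₂, N) · ‖v − v'‖`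
for every `N ≥ 1` — per-site moduli at the common floors `min(√S, √S')` ((o) + (p)), summed uniformly in the planar parts (§2). -/
theorem norm_layerForce_sub_le_of_height {ν a b v v' : E3} {t : ℝ} (hν : ‖ν‖ = 1) (hνa : ⟪ν, a⟫ = 0) (hνb : ⟪ν, b⟫ = 0)
    (hab : LinearIndependent ℝ ![a, b]) (ht : 0 < t) (htv : t ^ 2 ≤ ⟪ν, v⟫ ^ 2) (htv' : t ^ 2 ≤ ⟪ν, v'⟫ ^ 2) {N : ℕ}
    (hN : 1 ≤ N) :
    ‖layerForce a b v - layerForce a b v'‖ ≤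
      2 * ((15 * (t ^ 2)⁻¹ ^ 3 + 9) * (lineBound (t ^ 2 / 2) (qA a b) N * lineBound (t ^ 2 / 2) (qB a b) N)) * ‖v - v'‖ := by
  have ha0 : a ≠ 0 := by simpa using hab.ne_zero 0
  have hb0 : b ≠ 0 := by simpa using hab.ne_zero 1
  have hq₁ := qA_pos hab
  have hq₂ := qB_pos hab
  obtain ⟨c₁, c₂, hv⟩ := exists_planar hab hν hνa hνb v
  obtain ⟨c₁', c₂', hv'⟩ := exists_planar hab hν hνa hνb v'
  have hS : ∀ ij, 0 < siteSq t (qA a b) (qB a b) c₁ c₂ ij := fun ij => siteSq_pos ht hq₁.le hq₂.le c₁ c₂ ij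
  have hS' : ∀ ij, 0 < siteSq t (qA a b) (qB a b) c₁' c₂' ij := fun ij => siteSq_pos ht hq₁.le hq₂.le c₁' c₂' ij
  have hr : ∀ ij : ℤ × ℤ, 0 < min (Real.sqrt (siteSq t (qA a b) (qB a b) c₁ c₂ ij)) (Real.sqrt (siteSq t (qA a b) (qB a b) c₁' c₂' ij)) :=
    fun ij => lt_min (Real.sqrt_pos.2 (hS ij)) (Real.sqrt_pos.2 (hS' ij))
  have hrv : ∀ ij : ℤ × ℤ, min (Real.sqrt (siteSq t (qA a b) (qB a b) c₁ c₂ ij)) (Real.sqrt (siteSq t (qA a b) (qB a b) c₁' c₂' ij)) ≤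
      ‖v + ((ij.1 : ℝ) • a + (ij.2 : ℝ) • b)‖ :=
    fun ij => (min_le_left _ _).trans (sqrt_siteSq_le_norm hν hνa hνb ha0 hb0 hv htv ij)
  have hrv' : ∀ ij : ℤ × ℤ, min (Real.sqrt (siteSq t (qA a b) (qB a b) c₁ c₂ ij)) (Real.sqrt (siteSq t (qA a b) (qB a b) c₁' c₂' ij)) ≤
      ‖v' + ((ij.1 : ℝ) • a + (ij.2 : ℝ) • b)‖ :=
    fun ij => (min_le_right _ _).trans (sqrt_siteSq_le_norm hν hνa hνb ha0 hb0 hv' htv' ij)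
  have hM := summable_modulus_siteSq ht hq₁ hq₂ c₁ c₂
  have hM' := summable_modulus_siteSq ht hq₁ hq₂ c₁' c₂'
  have hsum : Summable fun ij : ℤ × ℤ =>
      modulus (Real.sqrt (siteSq t (qA a b) (qB a b) c₁ c₂ ij)) + modulus (Real.sqrt (siteSq t (qA a b) (qB a b) c₁' c₂' ij)) :=
    hM.add hM'
  have hle : ∀ ij : ℤ × ℤ,
      modulus (min (Real.sqrt (siteSq t (qA a b) (qB a b) c₁ c₂ ij)) (Real.sqrt (siteSq t (qA a b) (qB a b) c₁' c₂' ij))) ≤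
        modulus (Real.sqrt (siteSq t (qA a b) (qB a b) c₁ c₂ ij)) + modulus (Real.sqrt (siteSq t (qA a b) (qB a b) c₁' c₂' ij)) :=
    fun ij => modulus_min_le _ _
  have hμ : Summable fun ij : ℤ × ℤ =>
      modulus (min (Real.sqrt (siteSq t (qA a b) (qB a b) c₁ c₂ ij)) (Real.sqrt (siteSq t (qA a b) (qB a b) c₁' c₂' ij))) :=
    Summable.of_nonneg_of_le (fun ij => modulus_nonneg _) hle hsum
  have hLip := norm_layerForce_sub_le_of_floor (a := a) (b := b) (v := v) (v' := v')
    (r := fun ij => min (Real.sqrt (siteSq t (qA a b) (qB a b) c₁ c₂ ij)) (Real.sqrt (siteSq t (qA a b) (qB a b) c₁' c₂' ij)))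
    (Φ := modulus) (fun hs hx hy => pairForce_sub_le_modulus hs hx hy) hr hrv hrv' hμ
    (summable_layer hν hνa hνb hab ht htv) (summable_layer hν hνa hνb hab ht htv')
  have hbd : ∑' ij : ℤ × ℤ,
      modulus (min (Real.sqrt (siteSq t (qA a b) (qB a b) c₁ c₂ ij)) (Real.sqrt (siteSq t (qA a b) (qB a b) c₁' c₂' ij))) ≤
        2 * ((15 * (t ^ 2)⁻¹ ^ 3 + 9) * (lineBound (t ^ 2 / 2) (qA a b) N * lineBound (t ^ 2 / 2) (qB a b) N)) := by
    have h1 := tsum_modulus_le ht hq₁ hq₂ c₁ c₂ hN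
    have h2 := tsum_modulus_le ht hq₁ hq₂ c₁' c₂' hN
    calc ∑' ij : ℤ × ℤ,
          modulus (min (Real.sqrt (siteSq t (qA a b) (qB a b) c₁ c₂ ij)) (Real.sqrt (siteSq t (qA a b) (qB a b) c₁' c₂' ij)))
        ≤ ∑' ij : ℤ × ℤ, (modulus (Real.sqrt (siteSq t (qA a b) (qB a b) c₁ c₂ ij)) +
            modulus (Real.sqrt (siteSq t (qA a b) (qB a b) c₁' c₂' ij))) := hμ.tsum_le_tsum hle hsum
      _ = ∑' ij : ℤ × ℤ, modulus (Real.sqrt (siteSq t (qA a b) (qB a b) c₁ c₂ ij)) +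
            ∑' ij : ℤ × ℤ, modulus (Real.sqrt (siteSq t (qA a b) (qB a b) c₁' c₂' ij)) := hM.tsum_add hM'
      _ ≤ 2 * ((15 * (t ^ 2)⁻¹ ^ 3 + 9) * (lineBound (t ^ 2 / 2) (qA a b) N * lineBound (t ^ 2 / 2) (qB a b) N)) := by linarith
  exact hLip.trans (mul_le_mul_of_nonneg_right hbd (norm_nonneg _))

/-! ## §5 Span moduli `τ s = K s⁻⁶` and the pair modulus from a height floor -/

/-- the span-modulus constant `K(θ, q₁, q₂)`: the span moduli are `τ s = K · s⁻⁶`. -/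
def spanConst (θ q₁ q₂ : ℝ) : ℝ :=
  2 * ((15 * θ⁻¹ ^ 6 + 9) * ((20 * θ⁻¹ ^ 4 + 2 * q₁⁻¹ ^ 2) * (20 * θ⁻¹ ^ 4 + 2 * q₂⁻¹ ^ 2)))

/-- `0 ≤ spanConst θ q₁ q₂`. [folklore] -/
theorem spanConst_nonneg (θ q₁ q₂ : ℝ) : 0 ≤ spanConst θ q₁ q₂ := by unfold spanConst; positivity

/-- the one-dimensional bound at `p = (sθ)²/2`, `N = s`: `≤ (20 θ⁻⁴ + 2 q⁻²) s⁻³`. -/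
theorem lineBound_span_le {θ : ℝ} (hθ : 0 < θ) (q : ℝ) {s : ℕ} (hs : 1 ≤ s) :
    lineBound (((s : ℝ) * θ) ^ 2 / 2) q s ≤ (20 * θ⁻¹ ^ 4 + 2 * q⁻¹ ^ 2) * (s : ℝ)⁻¹ ^ 3 := by
  have hs' : (1 : ℝ) ≤ s := by exact_mod_cast hs
  have hs0 : (0 : ℝ) < s := by linarith
  have e : (((s : ℝ) * θ) ^ 2 / 2)⁻¹ ^ 2 = 4 * (θ⁻¹ ^ 4 * (s : ℝ)⁻¹ ^ 4) := by ring
  have h3 : (2 * (s : ℝ) + 3) * (s : ℝ)⁻¹ ≤ 5 := by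
    rw [← div_eq_mul_inv, div_le_iff₀ hs0]; linarith
  have h2 : (2 * (s : ℝ) + 3) * (s : ℝ)⁻¹ ^ 4 ≤ 5 * (s : ℝ)⁻¹ ^ 3 := by
    calc (2 * (s : ℝ) + 3) * (s : ℝ)⁻¹ ^ 4 = ((2 * (s : ℝ) + 3) * (s : ℝ)⁻¹) * (s : ℝ)⁻¹ ^ 3 := by ring
      _ ≤ 5 * (s : ℝ)⁻¹ ^ 3 := mul_le_mul_of_nonneg_right h3 (by positivity)
  have h1 : (2 * (s : ℝ) + 3) * (4 * (θ⁻¹ ^ 4 * (s : ℝ)⁻¹ ^ 4)) ≤ 20 * θ⁻¹ ^ 4 * (s : ℝ)⁻¹ ^ 3 := by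
    calc (2 * (s : ℝ) + 3) * (4 * (θ⁻¹ ^ 4 * (s : ℝ)⁻¹ ^ 4)) = 4 * θ⁻¹ ^ 4 * ((2 * (s : ℝ) + 3) * (s : ℝ)⁻¹ ^ 4) := by ring
      _ ≤ 4 * θ⁻¹ ^ 4 * (5 * (s : ℝ)⁻¹ ^ 3) := mul_le_mul_of_nonneg_left h2 (by positivity)
      _ = 20 * θ⁻¹ ^ 4 * (s : ℝ)⁻¹ ^ 3 := by ring
  have eR : (20 * θ⁻¹ ^ 4 + 2 * q⁻¹ ^ 2) * (s : ℝ)⁻¹ ^ 3 = 20 * θ⁻¹ ^ 4 * (s : ℝ)⁻¹ ^ 3 + 2 * (q⁻¹ ^ 2 * (s : ℝ)⁻¹ ^ 3) := by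
    ring
  unfold lineBound
  rw [e, eR]
  linarith

/-- the modulus prefactor at `t = sθ ≥ θ`: `15 (t²)⁻³ + 9 ≤ 15 θ⁻⁶ + 9`. -/
theorem modFactor_span_le {θ : ℝ} (hθ : 0 < θ) {s : ℕ} (hs : 1 ≤ s) :
    15 * (((s : ℝ) * θ) ^ 2)⁻¹ ^ 3 + 9 ≤ 15 * θ⁻¹ ^ 6 + 9 := by
  have hs' : (1 : ℝ) ≤ s := by exact_mod_cast hs
  have hsθ : θ ≤ (s : ℝ) * θ := le_mul_of_one_le_left hθ.le hs'
  have e : (((s : ℝ) * θ) ^ 2)⁻¹ ^ 3 = ((s : ℝ) * θ)⁻¹ ^ 6 := by rw [← inv_pow, ← pow_mul]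
  rw [e]
  have h := pow_le_pow_left₀ (inv_nonneg.2 (by positivity)) (inv_anti₀ hθ hsθ) 6
  linarith

/-- ★ the span bound: the uniform Lipschitz constant of §4 at `t = sθ`, `N = s` is `≤ spanConst θ q₁ q₂ · s⁻⁶`. -/
theorem span_bound {θ : ℝ} (hθ : 0 < θ) (q₁ q₂ : ℝ) {s : ℕ} (hs : 1 ≤ s) :
    2 * ((15 * (((s : ℝ) * θ) ^ 2)⁻¹ ^ 3 + 9) *
        (lineBound (((s : ℝ) * θ) ^ 2 / 2) q₁ s * lineBound (((s : ℝ) * θ) ^ 2 / 2) q₂ s)) ≤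
      spanConst θ q₁ q₂ * (s : ℝ)⁻¹ ^ 6 := by
  have hA := modFactor_span_le hθ hs
  have hB₁ := lineBound_span_le hθ q₁ hs
  have hB₂ := lineBound_span_le hθ q₂ hs
  have hL₁ := lineBound_nonneg (((s : ℝ) * θ) ^ 2 / 2) q₁ s
  have hL₂ := lineBound_nonneg (((s : ℝ) * θ) ^ 2 / 2) q₂ s
  have h1 : lineBound (((s : ℝ) * θ) ^ 2 / 2) q₁ s * lineBound (((s : ℝ) * θ) ^ 2 / 2) q₂ s ≤
      ((20 * θ⁻¹ ^ 4 + 2 * q₁⁻¹ ^ 2) * (s : ℝ)⁻¹ ^ 3) * ((20 * θ⁻¹ ^ 4 + 2 * q₂⁻¹ ^ 2) * (s : ℝ)⁻¹ ^ 3) :=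
    mul_le_mul hB₁ hB₂ hL₂ (by positivity)
  have h2 : (15 * (((s : ℝ) * θ) ^ 2)⁻¹ ^ 3 + 9) *
        (lineBound (((s : ℝ) * θ) ^ 2 / 2) q₁ s * lineBound (((s : ℝ) * θ) ^ 2 / 2) q₂ s) ≤
      (15 * θ⁻¹ ^ 6 + 9) *
        (((20 * θ⁻¹ ^ 4 + 2 * q₁⁻¹ ^ 2) * (s : ℝ)⁻¹ ^ 3) * ((20 * θ⁻¹ ^ 4 + 2 * q₂⁻¹ ^ 2) * (s : ℝ)⁻¹ ^ 3)) :=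
    mul_le_mul hA h1 (mul_nonneg hL₁ hL₂) (by positivity)
  calc 2 * ((15 * (((s : ℝ) * θ) ^ 2)⁻¹ ^ 3 + 9) *
          (lineBound (((s : ℝ) * θ) ^ 2 / 2) q₁ s * lineBound (((s : ℝ) * θ) ^ 2 / 2) q₂ s))
      ≤ 2 * ((15 * θ⁻¹ ^ 6 + 9) *
          (((20 * θ⁻¹ ^ 4 + 2 * q₁⁻¹ ^ 2) * (s : ℝ)⁻¹ ^ 3) * ((20 * θ⁻¹ ^ 4 + 2 * q₂⁻¹ ^ 2) * (s : ℝ)⁻¹ ^ 3))) := by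
        linarith
    _ = spanConst θ q₁ q₂ * (s : ℝ)⁻¹ ^ 6 := by unfold spanConst; ring

/-- `Σ_s s³ · (K s⁻⁶) < ∞`. -/
theorem summable_cube_mul_spanModulus (K : ℝ) : Summable fun s : ℕ => (s : ℝ) ^ 3 * (K * (s : ℝ)⁻¹ ^ 6) := by
  have h : Summable fun s : ℕ => K * (1 / (s : ℝ) ^ 3) := (Real.summable_one_div_nat_pow.2 (by norm_num)).mul_left K
  refine h.congr fun s => ?_
  rcases Nat.eq_zero_or_pos s with hs | hs
  · subst hs; simp
  · have hs' : (s : ℝ) ≠ 0 := by positivity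
    have e : (s : ℝ) ^ 3 * (s : ℝ)⁻¹ ^ 6 = (s : ℝ)⁻¹ ^ 3 := by
      rw [show (s : ℝ)⁻¹ ^ 6 = (s : ℝ)⁻¹ ^ 3 * (s : ℝ)⁻¹ ^ 3 by ring, ← mul_assoc, ← mul_pow, mul_inv_cancel₀ hs', one_pow,
        one_mul]
    calc K * (1 / (s : ℝ) ^ 3) = K * ((s : ℝ) ^ 3 * (s : ℝ)⁻¹ ^ 6) := by rw [e, one_div, inv_pow]
      _ = (s : ℝ) ^ 3 * (K * (s : ℝ)⁻¹ ^ 6) := by ring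

/-- ★★ THE PAIR MODULUS FROM A HEIGHT FLOOR (configuration level, design-neutral).  For independent planar periods `a, b`, a unit
normal `ν` and a centre sequence `w` whose increments all have `ν`-height `≥ h₀ > ρ`, the layer-pair force is `τ s`-Lipschitz along the
`ρ`-tube with `τ s = spanConst (h₀ − ρ) (qA a b) (qB a b) · s⁻⁶`. -/
theorem isPairModulus_of_heightFloor {ν a b : E3} {w : ℤ → E3} {ρ h₀ : ℝ} (hν : ‖ν‖ = 1) (hνa : ⟪ν, a⟫ = 0) (hνb : ⟪ν, b⟫ = 0)
    (hab : LinearIndependent ℝ ![a, b]) (hw : ∀ i, h₀ ≤ ⟪ν, incr w i⟫) (hρ : ρ < h₀) :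
    IsPairModulus a b w ρ (fun s => spanConst (h₀ - ρ) (qA a b) (qB a b) * (s : ℝ)⁻¹ ^ 6) := by
  intro k l hkl h h' hh hh'
  have hθ : 0 < h₀ - ρ := sub_pos.2 hρ
  obtain ⟨n, hn⟩ : ∃ n : ℕ, (l - k).toNat = n := ⟨_, rfl⟩
  have hn1 : 1 ≤ n := by omega
  have hnZ : ((n : ℕ) : ℤ) = l - k := by omega
  have hnR : (n : ℝ) = ((l - k : ℤ) : ℝ) := by exact_mod_cast hnZ
  rw [hn]
  show ‖layerForce a b (-offsetOf h k l) - layerForce a b (-offsetOf h' k l)‖ ≤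
    spanConst (h₀ - ρ) (qA a b) (qB a b) * (n : ℝ)⁻¹ ^ 6 * ‖offsetOf h k l - offsetOf h' k l‖
  have hH : (n : ℝ) * (h₀ - ρ) ≤ ⟪ν, offsetOf h k l⟫ := by
    have := le_inner_offsetOf hν hh hw hkl.le; rwa [← hnR] at this
  have hH' : (n : ℝ) * (h₀ - ρ) ≤ ⟪ν, offsetOf h' k l⟫ := by
    have := le_inner_offsetOf hν hh' hw hkl.le; rwa [← hnR] at this
  have ht : 0 < (n : ℝ) * (h₀ - ρ) := by
    have : (1 : ℝ) ≤ n := by exact_mod_cast hn1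
    positivity
  have htv : ((n : ℝ) * (h₀ - ρ)) ^ 2 ≤ ⟪ν, -offsetOf h k l⟫ ^ 2 := by
    rw [inner_neg_right, neg_sq]; exact pow_le_pow_left₀ ht.le hH 2
  have htv' : ((n : ℝ) * (h₀ - ρ)) ^ 2 ≤ ⟪ν, -offsetOf h' k l⟫ ^ 2 := by
    rw [inner_neg_right, neg_sq]; exact pow_le_pow_left₀ ht.le hH' 2
  have key := norm_layerForce_sub_le_of_height hν hνa hνb hab ht htv htv' hn1
  rw [show -offsetOf h k l - -offsetOf h' k l = -(offsetOf h k l - offsetOf h' k l) by abel, norm_neg] at key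
  exact key.trans (mul_le_mul_of_nonneg_right (span_bound hθ (qA a b) (qB a b) hn1) (norm_nonneg _))

/-- ★★ packaged: span moduli `τ ≥ 0` with `Σ s³ τ s < ∞` on the `ρ`-tube, from a height floor `h₀ > ρ`. -/
theorem pairModulus_of_heightFloor {ν a b : E3} {w : ℤ → E3} {ρ h₀ : ℝ} (hν : ‖ν‖ = 1) (hνa : ⟪ν, a⟫ = 0) (hνb : ⟪ν, b⟫ = 0)
    (hab : LinearIndependent ℝ ![a, b]) (hw : ∀ i, h₀ ≤ ⟪ν, incr w i⟫) (hρ : ρ < h₀) :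
    ∃ τ : ℕ → ℝ, (∀ s, 0 ≤ τ s) ∧ Summable (fun s : ℕ => (s : ℝ) ^ 3 * τ s) ∧ IsPairModulus a b w ρ τ :=
  ⟨fun s => spanConst (h₀ - ρ) (qA a b) (qB a b) * (s : ℝ)⁻¹ ^ 6,
    fun s => mul_nonneg (spanConst_nonneg _ _ _) (by positivity), summable_cube_mul_spanModulus _,
    isPairModulus_of_heightFloor hν hνa hνb hab hw hρ⟩

/-- ★★ 7c′ᴾ FOR CLEAN STACKED CONFIGURATIONS.  For `aHi ≤ 8/7` (lens-4's `IsCleanW` is `IsCleanP (103/100)`), every `δ`-separated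
`IsCleanP aHi` stacked layered LJ configuration with `‖a‖, ‖b‖ ≤ 17/16` carries span moduli with finite third moment on every `ρ`-tube with
`ρ < 19/50` — the uniform layer windows of `…StackedUniform.stackedUniform` give the height floor `min(192/425, 8/17) · 27/32 ≥ 19/50 > ρ`.
(In particular at the radius of record `ρ₀ = 1/40`.) -/
theorem pairModulus_of_cleanP_stacked {aHi : ℝ} (haHi : aHi ≤ 8 / 7) {ρ : ℝ} (hρ : ρ < 19 / 50) {δ : ℝ} (hδ : 0 < δ) {a b : E3}
    {w : ℤ → E3} (hsep : IsSep δ (Layered a b w)) (hclean : IsCleanP aHi (μS (Layered a b w))) (hst : IsStacked a b w)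
    (han : ‖a‖ ≤ 17 / 16) (hbn : ‖b‖ ≤ 17 / 16) :
    ∃ τ : ℕ → ℝ, (∀ s, 0 ≤ τ s) ∧ Summable (fun s : ℕ => (s : ℝ) ^ 3 * τ s) ∧ IsPairModulus a b w ρ τ := by
  obtain ⟨ν, hν1, hνa, hνb, -, ha27, -, -, hTS⟩ := stackedUniform haHi hδ hsep hclean hst han hbn
  have hab : LinearIndependent ℝ ![a, b] := linearIndependent_of_cleanP_stacked haHi hδ hsep hclean hst
  have hw : ∀ i, (19 / 50 : ℝ) ≤ ⟪ν, incr w i⟫ := fun i => by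
    have e : incr w i = w (i - 1 + 1) - w (i - 1) := by rw [sub_add_cancel]; rfl
    rw [e]
    rcases hTS with ⟨-, hT⟩ | ⟨-, hS⟩
    · have h := (hT (i - 1)).1; nlinarith
    · have h := (hS (i - 1)).1; nlinarith
  exact pairModulus_of_heightFloor hν1 hνa hνb hab hw hρ

end Summit.AtomisticToContinuum.Crystallization.Theorems.ChartedPlanarOrderPairModulus
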